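import Literature.NumberTheory.NumberFields.RayClassFieldAdicCharacterLocalUnits
import Literature.NumberTheory.NumberFields.RayClassFieldAdicCharacterTower
import Mathlib.LinearAlgebra.FreeModule.IdealQuotient
import HarnessLib

/-!
# The ABSOLUTE Lubin–Tate model at a PRINCIPAL split prime `v = (α₀)`: the parameters `f`, `α = α₀^f ≡ 1 mod 𝔪`, `u = α₀/2 ∈ 𝒪_vˣ`
# with `α = (u·2)^f` of the one-`𝔓` assembly of de Shalit II.4.12 EXIST (hypotheses `hα0 hα𝔪 hαw hαπ` discharged when `v` is principal)

Cell `bsd-print-cf2`, width seat `bsd-line-cf2c-w4` g10; `--supports` stmt-BirchSwinnertonDyer-24721 (helper, Theses-free). THEOREMS ONLY;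
no named facts.

The one-`𝔓` assembly `exists_groupDistribution_twisting_eq_induce_ellipticUnitsLocal(_of_principal)` (p747710 / `…MeasurePrincipal`) and the
containment / disjointness / norm files `RayClassFieldLocalTower*` model de Shalit's relative Lubin–Tate situation at `𝔭 = v` (II.4.3: base
`Φ = K_𝔭·ι(K(𝔣))` unramified of degree `f`, parameter `ψ(𝔭^f) = α`) by an ABSOLUTE Lubin–Tate group over `K_v` with uniformizer `π = u·2 ∈ K_v`
and `α = π^f`: hypotheses `hα0 : α ≠ 0`, `hα𝔪 : α − 1 ∈ 𝔪`, `hαw : α ∉ w (w ≠ v)`, `hαπ : α = (u·2)^f in K_v`.  This forces `α` to be an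
`f`-th power of a uniformizer of `K_v` — automatic when `v = (α₀)` is PRINCIPAL (the case of every `K` of class number one, e.g. the CM
fields of elliptic curves over `ℚ`): take `f :=` the order of `α₀` in `(𝒪_K/𝔪)ˣ`, `α := α₀^f`, `u := α₀/2 ∈ 𝒪_vˣ` (`2` and `α₀` are both
uniformizers of `K_v` when `𝒪_v ≅ ℤ₂`).  (For non-principal `v` the absolute model can fail — e.g. `K = ℚ(√−15)`, `v ∣ 2`, where
`α/2^f ≡ 5 mod 8` is never in `(ℤ₂ˣ)^f` — and de Shalit's genuinely relative groups, parameter `ξ ∈ Φ` with `N_{Φ/K_𝔭} ξ = α`, would be needed;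
not done here.)

* §1 `sup_eq_top_of_not_le`, ★ `exists_pow_sub_one_mem_of_asIdeal_eq_span` — **`∃ f ≥ 1, α₀^f ≡ 1 mod 𝔪`** for `v = (α₀)`, `v ∤ 𝔪` (`𝒪_K/𝔪` is finite);
  `ne_zero_of_asIdeal_eq_span`, `pow_not_mem_of_ne` (`α₀^f ∉ w` for `w ≠ v`);
* §2 `intValuation_eq_exp_neg_one_of_asIdeal_eq_span` (`v(α₀) = 1`), `valued_natCast_two_eq_exp_neg_one` (`v(2) = 1` from `e₂ : 𝒪_v ≃+* ℤ₂`),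
  ★ `exists_unit_mul_two_eq` — **`∃ u ∈ 𝒪[K_v]ˣ, u·2 = α₀` in `K_v`**;
* §3 ★★ `exists_absoluteModel_of_asIdeal_eq_span` — **`∃ f ≥ 1, ∃ u, α₀^f ≠ 0 ∧ α₀^f − 1 ∈ 𝔪 ∧ (∀ w ≠ v, α₀^f ∉ w) ∧ α₀^f = (u·2)^f in `K_v`**
  — the data `(f, α, u)` with `hα0 hα𝔪 hαw hαπ` of the assembly VERBATIM.

HONEST FRAMING: elementary plumbing; nothing here closes a crux; no summit statement is proved; BSD is not proved by any of this.

## References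
* [deShalit1987] E. de Shalit, *Iwasawa theory of elliptic curves with complex multiplication* (1987), I.1.2–1.3 (p. 7–9), II.4.3 (p. 57),
  II.4.12 (p. 66–69).
* [NeukirchANT1999] J. Neukirch, *Algebraic Number Theory* (1999), Ch. I §3 (3.1), Ch. II §4.
-/

-- the summit namespace `Summit.BirchSwinnertonDyer.BirchSwinnertonDyer` repeats the problem name by design (D-0017)
set_option linter.dupNamespace false
set_option autoImplicit false

noncomputable section

open scoped Classical nonZeroDivisors NumberField ValuativeRel
open IsDedekindDomain IsDedekindDomain.HeightOneSpectrum
open Literature.NumberTheory.NumberFields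

namespace Summit.BirchSwinnertonDyer.BirchSwinnertonDyer.Theorems.PrintCf2.EllipticUnitsLocal

variable {K : Type} [Field K] [NumberField K] {𝔪 : Ideal (𝓞 K)} {v : HeightOneSpectrum (𝓞 K)}

/-! ## §1. `α₀^f ≡ 1 mod 𝔪` for the generator of a principal prime `v = (α₀) ∤ 𝔪` -/

section Global

/-- `(α₀) ⊔ 𝔪 = ⊤` for the maximal ideal `v = (α₀)` not containing `𝔪`. [cite: NeukirchANT1999, Ch. I §3 (3.1)] -/
theorem sup_eq_top_of_not_le (hv : ¬ 𝔪 ≤ v.asIdeal) {α₀ : 𝓞 K} (hv0 : v.asIdeal = Ideal.span {α₀}) :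
    Ideal.span {α₀} ⊔ 𝔪 = ⊤ := by
  rw [← hv0]
  by_contra h
  obtain ⟨M, hM, hle⟩ := Ideal.exists_le_maximal _ h
  have hvM : v.asIdeal = M := v.isMaximal.eq_of_le hM.ne_top (le_sup_left.trans hle)
  exact hv (hvM ▸ le_sup_right.trans hle)

omit [NumberField K] in
/-- `α₀ ≠ 0` for `v = (α₀)`. [folklore] -/
theorem ne_zero_of_asIdeal_eq_span {α₀ : 𝓞 K} (hv0 : v.asIdeal = Ideal.span {α₀}) : α₀ ≠ 0 := by
  rintro rfl
  exact v.ne_bot (by rw [hv0, Ideal.span_singleton_eq_bot])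

/-- `α₀^f ∉ w` for every prime `w ≠ v = (α₀)`. [cite: NeukirchANT1999, Ch. I §3 (3.1)] -/
theorem pow_not_mem_of_ne {α₀ : 𝓞 K} (hv0 : v.asIdeal = Ideal.span {α₀}) (w : HeightOneSpectrum (𝓞 K)) (hw : w ≠ v) (f : ℕ) :
    α₀ ^ f ∉ w.asIdeal := by
  intro h
  have hα : α₀ ∈ w.asIdeal := w.isPrime.mem_of_pow_mem f h
  have hle : v.asIdeal ≤ w.asIdeal := by rw [hv0, Ideal.span_singleton_le_iff_mem]; exact hα
  exact hw (HeightOneSpectrum.ext (v.isMaximal.eq_of_le w.isPrime.ne_top hle)).symm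

/-- ★ **`∃ f ≥ 1, α₀^f ≡ 1 mod 𝔪`** for `v = (α₀)`, `v ∤ 𝔪`, `𝔪 ≠ 0`: the order of `α₀` in the finite group `(𝒪_K/𝔪)ˣ` — de Shalit's
`f` = order of `𝔭` in the ray class group mod `𝔣`, `ψ(𝔭^f) = α` (for principal `𝔭 = (α₀)`: `α = α₀^f`).  (The `IsCoprime` form of this
elementary fact is `Literature.NumberTheory.Automorphic.exists_pow_sub_one_mem`, not imported here to keep the closure small.)
[cite: deShalit1987, II.4.3 (p. 57)] -/
theorem exists_pow_sub_one_mem_of_asIdeal_eq_span (h𝔪0 : 𝔪 ≠ ⊥) (hv : ¬ 𝔪 ≤ v.asIdeal) {α₀ : 𝓞 K} (hv0 : v.asIdeal = Ideal.span {α₀}) :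
    ∃ f : ℕ, 0 < f ∧ α₀ ^ f - 1 ∈ 𝔪 := by
  have h1 : (1 : 𝓞 K) ∈ Ideal.span {α₀} ⊔ 𝔪 := by rw [sup_eq_top_of_not_le hv hv0]; exact Submodule.mem_top
  obtain ⟨a, b, hb, hab⟩ := Ideal.mem_span_singleton_sup.mp h1
  haveI : Finite (𝓞 K ⧸ 𝔪) := Ideal.finiteQuotientOfFreeOfNeBot 𝔪 h𝔪0
  have hu : Ideal.Quotient.mk 𝔪 α₀ * Ideal.Quotient.mk 𝔪 a = 1 := by
    rw [← map_mul, ← map_one (Ideal.Quotient.mk 𝔪), Ideal.Quotient.eq]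
    have hrw : α₀ * a - 1 = -b := by rw [← hab]; ring
    rw [hrw]
    exact 𝔪.neg_mem hb
  set U : (𝓞 K ⧸ 𝔪)ˣ := Units.mkOfMulEqOne _ _ hu with hU
  refine ⟨orderOf U, orderOf_pos U, ?_⟩
  rw [← Ideal.Quotient.eq_zero_iff_mem, map_sub, map_one, map_pow, sub_eq_zero]
  have h := congrArg (fun x : (𝓞 K ⧸ 𝔪)ˣ ↦ (x : 𝓞 K ⧸ 𝔪)) (pow_orderOf_eq_one U)
  simpa only [Units.val_pow_eq_pow_val, hU, Units.val_mkOfMulEqOne, Units.val_one] using h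

end Global

/-! ## §2. In `K_v` (`𝒪_v ≅ ℤ₂`): `α₀` and `2` are uniformizers, so `α₀ = u·2` with `u ∈ 𝒪[K_v]ˣ` -/

section Local

/-- `v(α₀) = 1` for `v = (α₀)` (`α₀ ∈ v ∖ v²`). [cite: NeukirchANT1999, Ch. I §3 (3.1)] -/
theorem intValuation_eq_exp_neg_one_of_asIdeal_eq_span {α₀ : 𝓞 K} (hv0 : v.asIdeal = Ideal.span {α₀}) :
    v.intValuation α₀ = WithZero.exp (-1 : ℤ) := by
  have hα0 := ne_zero_of_asIdeal_eq_span hv0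
  have h1 : v.intValuation α₀ ≤ WithZero.exp (-(1 : ℕ) : ℤ) := by
    rw [intValuation_le_pow_iff_mem, pow_one, hv0]; exact Ideal.mem_span_singleton_self α₀
  have h2 : ¬ v.intValuation α₀ ≤ WithZero.exp (-(2 : ℕ) : ℤ) := by
    rw [intValuation_le_pow_iff_mem]
    intro h
    have hle : v.asIdeal ^ 1 ≤ v.asIdeal ^ 2 := by
      rw [pow_one, hv0, Ideal.span_singleton_le_iff_mem]; exact hv0 ▸ h
    exact (lt_irrefl _ ((Ideal.pow_succ_lt_pow v.ne_bot 1).trans_le hle))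
  rw [v.intValuation_if_neg hα0] at h1 h2 ⊢
  rw [WithZero.exp_le_exp] at h1 h2
  rw [WithZero.exp_inj]
  omega

/-- `v(α₀) = 1` read in the completion: `Valued.v (α₀ : K_v) = exp (−1)`. [cite: NeukirchANT1999, Ch. II §4] -/
theorem valued_coe_eq_exp_neg_one_of_asIdeal_eq_span {α₀ : 𝓞 K} (hv0 : v.asIdeal = Ideal.span {α₀}) :
    Valued.v (((α₀ : 𝓞 K) : K) : v.adicCompletion K) = WithZero.exp (-1 : ℤ) := by
  rw [valuedAdicCompletion_eq_valuation', valuation_of_algebraMap, intValuation_eq_exp_neg_one_of_asIdeal_eq_span hv0]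

/-- `v(2) = 1` in `K_v` when `𝒪_v ≅ ℤ₂` (`2 = e₂⁻¹ 2` is a uniformizer, cf2c-w4 g8's `valued_symm_natCast_eq_exp_neg_one`).
[cite: deShalit1987, II.1.1 (p. 32)] -/
theorem valued_natCast_two_eq_exp_neg_one (e₂ : v.adicCompletionIntegers K ≃+* ℤ_[2]) :
    Valued.v (((2 : ℕ) : v.adicCompletion K)) = WithZero.exp (-1 : ℤ) := by
  have h := valued_symm_natCast_eq_exp_neg_one e₂
  rwa [map_natCast, SubringClass.coe_natCast] at h

/-- ★ **`α₀ = u·2` with `u ∈ 𝒪[K_v]ˣ`** (`v = (α₀)`, `𝒪_v ≅ ℤ₂`: `α₀/2` has valuation `0`).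
[cite: deShalit1987, II.4.3 (p. 57), I.1.2 (p. 7)] -/
theorem exists_unit_mul_two_eq (e₂ : v.adicCompletionIntegers K ≃+* ℤ_[2]) {α₀ : 𝓞 K} (hv0 : v.asIdeal = Ideal.span {α₀}) :
    ∃ u : (𝒪[v.adicCompletion K])ˣ,
      ((((u : 𝒪[v.adicCompletion K]) * ((2 : ℕ) : 𝒪[v.adicCompletion K]) : 𝒪[v.adicCompletion K]) : v.adicCompletion K)) =
        ((α₀ : K) : v.adicCompletion K) := by
  have hα := valued_coe_eq_exp_neg_one_of_asIdeal_eq_span hv0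
  have h2 := valued_natCast_two_eq_exp_neg_one e₂
  have h20 : ((2 : ℕ) : v.adicCompletion K) ≠ 0 := by
    intro h; rw [h, map_zero] at h2; exact WithZero.zero_ne_coe h2
  set y : v.adicCompletion K := ((α₀ : K) : v.adicCompletion K) / ((2 : ℕ) : v.adicCompletion K) with hy
  have hyv : Valued.v y = 1 := by rw [hy, map_div₀, hα, h2, div_self (WithZero.coe_ne_zero)]
  have hy0 : y ≠ 0 := by intro h; rw [h, map_zero] at hyv; exact zero_ne_one hyv
  have hyv' : Valued.v y⁻¹ = 1 := by rw [map_inv₀, hyv, inv_one]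
  have hmem : y ∈ 𝒪[v.adicCompletion K] :=
    (mem_integer_iff_mem_adicCompletionIntegers v y).mpr (by rw [mem_adicCompletionIntegers, hyv])
  have hmem' : y⁻¹ ∈ 𝒪[v.adicCompletion K] :=
    (mem_integer_iff_mem_adicCompletionIntegers v y⁻¹).mpr (by rw [mem_adicCompletionIntegers, hyv'])
  refine ⟨⟨⟨y, hmem⟩, ⟨y⁻¹, hmem'⟩, Subtype.ext (mul_inv_cancel₀ hy0), Subtype.ext (inv_mul_cancel₀ hy0)⟩, ?_⟩
  show y * (((2 : ℕ) : 𝒪[v.adicCompletion K]) : v.adicCompletion K) = _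
  rw [SubringClass.coe_natCast, hy, div_mul_cancel₀ _ h20]

end Local

/-! ## §3. The absolute model's parameters at a principal split prime -/

/-- `K → K_v` is multiplicative on powers. [folklore] -/
theorem coe_pow_adicCompletion (x : K) (n : ℕ) :
    (((x ^ n : K)) : v.adicCompletion K) = ((x : v.adicCompletion K)) ^ n := by
  induction n with
  | zero => rw [pow_zero, pow_zero, adicCompletion.coe_one]
  | succ n ih => rw [pow_succ, pow_succ, adicCompletion.coe_mul, ih]

/-- ★★ **The absolute Lubin–Tate model exists at a principal `v = (α₀)` with `𝒪_v ≅ ℤ₂`** (`𝔪 ≠ 0`, `v ∤ 𝔪`): there are `f ≥ 1` and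
`u ∈ 𝒪[K_v]ˣ` with `α := α₀^f ≠ 0`, `α ≡ 1 mod 𝔪`, `α ∉ w` for every `w ≠ v`, and `α = (u·2)^f` in `K_v` — the data `(f, α, u)` and the
hypotheses `hα0 hα𝔪 hαw hαπ` of `exists_groupDistribution_twisting_eq_induce_ellipticUnitsLocal` VERBATIM (de Shalit's `ψ(𝔭^f) = α`
with `𝔭 = (α₀)` principal). [cite: deShalit1987, II.4.3 (p. 57), II.4.12 (p. 66–69)] -/
theorem exists_absoluteModel_of_asIdeal_eq_span (h𝔪0 : 𝔪 ≠ ⊥) (hv : ¬ 𝔪 ≤ v.asIdeal)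
    (e₂ : v.adicCompletionIntegers K ≃+* ℤ_[2]) {α₀ : 𝓞 K} (hv0 : v.asIdeal = Ideal.span {α₀}) :
    ∃ (f : ℕ) (u : (𝒪[v.adicCompletion K])ˣ), 0 < f ∧ α₀ ^ f ≠ 0 ∧ α₀ ^ f - 1 ∈ 𝔪 ∧
      (∀ w : HeightOneSpectrum (𝓞 K), w ≠ v → α₀ ^ f ∉ w.asIdeal) ∧
      (((α₀ ^ f : 𝓞 K) : K) : v.adicCompletion K) =
        ((((u : 𝒪[v.adicCompletion K]) * ((2 : ℕ) : 𝒪[v.adicCompletion K]) : 𝒪[v.adicCompletion K]) : v.adicCompletion K)) ^ f := by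
  obtain ⟨f, hf, hf𝔪⟩ := exists_pow_sub_one_mem_of_asIdeal_eq_span h𝔪0 hv hv0
  obtain ⟨u, hu⟩ := exists_unit_mul_two_eq e₂ hv0
  refine ⟨f, u, hf, pow_ne_zero f (ne_zero_of_asIdeal_eq_span hv0), hf𝔪, fun w hw ↦ pow_not_mem_of_ne hv0 w hw f, ?_⟩
  have h1 : ((α₀ ^ f : 𝓞 K) : K) = ((α₀ : 𝓞 K) : K) ^ f := by
    rw [NumberField.RingOfIntegers.coe_eq_algebraMap, map_pow, ← NumberField.RingOfIntegers.coe_eq_algebraMap]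
  rw [h1, coe_pow_adicCompletion, hu]

end Summit.BirchSwinnertonDyer.BirchSwinnertonDyer.Theorems.PrintCf2.EllipticUnitsLocal

end
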